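import Literature.NumberTheory.EllipticCurves.CasselsTateLocalTerms
import Literature.NumberTheory.EllipticCurves.LocalEulerCharacteristicTorsion
import Literature.NumberTheory.EllipticCurves.ZpExtensionUnramifiedProofs
import HarnessLib

/-!
# `𝓛_v^⊥ ⊆ 𝓛_v` for `inv ∘ weilLocalCup` at a finite place `v ∤ p`, level `m² = p^k` (the hypothesis `hperp`
# of `CasselsTateLocalTermLine`), unconditionally

Topic `NumberTheory/EllipticCurves`; namespace `Literature.NumberTheory.EllipticCurves`. THEOREMS ONLY: **no
definition and no named fact** (D-0026). Discharges, at every finite place `v ∤ p` of a number field `K` and every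
prime-power level `m² = p^k`, the maximal-isotropy hypothesis
`hperp : ∀ x, (∀ y ∈ 𝓛, inv (weilLocalCup W m K_v e … x y) = 0) → x ∈ 𝓛` of
`CasselsTateLocalTermLine.inv_weilLocalCup_ne_zero_or_of_line` (#40), for any INJECTIVE reading `inv` of
`H²(Γ_{K_v}, μ_{m²})`, from the tree's local Tate duality for `E`
(`forall_mem_kummerLocalConditionAt_weilCupProduct_eq_zero_iff_of_eulerChar`, Milne I Cor. 3.4 / Lemma 6.15,
Poonen–Rains Prop. 4.10) fed with Tate's local Euler characteristic off `p`
(`natCard_invariants_mul_natCard_two_eq`, Milne I Thm. 2.8 / Lemma 2.9) — the generic-level twin of the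
`GenusKolyvaginAtTwo` lineage's `…LocalDualityOrder` / `…LocalDualityPerfect` (there at the syntactic level `p^k`;
here at a VARIABLE level `n` with `hn : n = p^k`, so that it applies at `n := m * m`, the level of the Cassels–Tate
local terms, where `2^κ * 2^κ` and `2^(2κ)` are not syntactically equal).

* `natCard_adicCompletionIntegers_quotient_span_natCast_eq_one` — `#(𝓞_v/n) = 1` for `v ∤ n`.
* `natCard_galoisCohomology_one_torsion_eq_sq_of_eq_pow` — `#H¹(K_v, E[n]) = #E(K_v)[n]²` for `n = p^k`, `k ≠ 0`,
  `v ∤ p`; `hEuler_of_eq_pow` — the same in the `hEuler` shape of `LocalTateDualityOrderForE`.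
* ★ `mem_kummerLocalConditionAt_of_forall_inv_weilLocalCup_eq_zero` — for `m * m = p^k`, `v ∤ p`, `e` alternating
  and non-degenerate, `inv` injective: `(∀ y ∈ 𝓛_v, inv (weilLocalCup W m K_v e … x y) = 0) → x ∈ 𝓛_v`.

References: [MilneADT2006] J. S. Milne, *Arithmetic Duality Theorems*, 2nd ed., I Thm. 2.8, Lemma 2.9, Cor. 3.4,
Lemma 6.15; [PoonenRains2012] B. Poonen, E. Rains, JAMS 25 (2012), Prop. 4.10; [McCallumLMS1991] W. G. McCallum,
LMS LN 153 (1991), §5 Lemma 5.3 (the perfectness half).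
-/

noncomputable section

open scoped Classical

universe u

namespace Literature.NumberTheory.EllipticCurves

open CategoryTheory _root_.WeierstrassCurve Field Function NumberField IsDedekindDomain
open Literature.NumberTheory.GaloisRepresentations
open Literature.NumberTheory.GaloisRepresentations.DiscreteGaloisModule (mu)
open scoped ContRepresentation

section Perp

variable {K : Type u} [Field K] [NumberField K] (v : HeightOneSpectrum (𝓞 K))

/-- **`#(𝓞_v / n𝓞_v) = 1` for `v ∤ n`**: `n` is a `v`-adic unit (`LocalPoints.valuation_natCast_eq_one`,
`LocalPoints.isUnit_iff_valuation_eq_one`). Literature-side restatement (same proof) of the `GenusKolyvaginAtTwo`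
lineage's `GenusExact.LocalDualityOrder.natCard_quotient_span_natCast_eq_one` (a `Summits/` theorem, not importable
here). [cite: MilneADT2006, Ch. I, Lemma 3.3] -/
theorem natCard_adicCompletionIntegers_quotient_span_natCast_eq_one {n : ℕ} (hn : (n : 𝓞 K) ∉ v.asIdeal) :
    Nat.card (v.adicCompletionIntegers K ⧸ Ideal.span {(n : v.adicCompletionIntegers K)}) = 1 := by
  have hu : IsUnit (n : v.adicCompletionIntegers K) := by
    rw [LocalPoints.isUnit_iff_valuation_eq_one v]
    have h := LocalPoints.valuation_natCast_eq_one v hn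
    rwa [← SubringClass.coe_natCast (v.adicCompletionIntegers K) n] at h
  rw [Ideal.span_singleton_eq_top.mpr hu]
  haveI : Subsingleton (v.adicCompletionIntegers K ⧸ (⊤ : Ideal (v.adicCompletionIntegers K))) :=
    Ideal.Quotient.subsingleton_iff.mpr rfl
  exact Nat.card_of_subsingleton 0

variable (W : WeierstrassCurve K) [W.IsElliptic]

/-- **`#H¹(K_v, E[n]) = #E(K_v)[n]²` for `n = p^k` (`k ≠ 0`) and `v ∤ p`, unconditionally** — Tate's local
Euler–Poincaré characteristic `#H⁰ · #H² = #H¹` for the `p`-primary module `E[n]` at residue characteristic `≠ p`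
(`natCard_invariants_mul_natCard_two_eq`) with `#H⁰ = #H² = #E(K_v)[n]`
(`natCard_invariants_torsion_restrictField`, `natCard_galoisCohomology_two_torsion_restrictField`); stated at a
variable level `n` (`hn : n = p^k`). [cite: MilneADT2006, Ch. I, Thm. 2.8 and Lemma 2.9] [cite: MilneADT2006, Ch. I, Cor. 2.3] -/
theorem natCard_galoisCohomology_one_torsion_eq_sq_of_eq_pow {p : ℕ} [Fact p.Prime] (n : ℕ) [NeZero n]
    {k : ℕ} (hk : k ≠ 0) (hn : n = p ^ k) (hpv : (p : 𝓞 K) ∉ v.asIdeal) :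
    Nat.card (galoisCohomology
        (GaloisRep.restrictField (v.adicCompletion K) (W.torsionGaloisModule (n : ℤ))) 1) =
      Nat.card (nsmulAddMonoidHom n :
          (W.baseChange (v.adicCompletion K)).toAffine.Point →+ _).ker ^ 2 := by
  haveI : CharZero (v.adicCompletion K) := charZero_adicCompletion v
  have hppow : IsPrimePow n := hn ▸ (Fact.out : p.Prime).isPrimePow.pow hk
  haveI : Finite (geomTorsion W (n : ℤ)) := finite_geomTorsion_of_neZero W n
  set F := v.adicCompletion K with hF
  set ρ : ContinuousRep (absoluteGaloisGroup F) ℤ (geomTorsion W (n : ℤ)) :=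
    GaloisRep.restrictField F (W.torsionGaloisModule (n : ℤ)) with hρ
  have hA : IsPrimaryTorsion p (geomTorsion W (n : ℤ)) :=
    IsPrimaryTorsion.of_forall_nsmul_eq_zero (r := k) fun T => by
      rw [← hn]; exact AddSubgroup.torsionBy.nsmul T
  have hℓ := (v.ringChar_residueField_adicCompletion_ne hpv).symm
  obtain ⟨-, hEq⟩ := natCard_invariants_mul_natCard_two_eq F ρ hA hℓ
  have h0 : Nat.card ρ.toTopRep.ρ.invariants =
      Nat.card (nsmulAddMonoidHom n : (W.baseChange F).toAffine.Point →+ _).ker :=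
    natCard_invariants_torsion_restrictField W F (NeZero.ne n)
  have h2 : Nat.card (continuousCohomology 2 ρ.toTopRep) =
      Nat.card (nsmulAddMonoidHom n : (W.baseChange F).toAffine.Point →+ _).ker :=
    (natCard_galoisCohomology_two_torsion_restrictField W F n hppow).2
  change Nat.card (continuousCohomology 1 ρ.toTopRep) = _
  rw [← hEq, h0, h2, sq]

/-- The same count in the `hEuler` shape of `LocalTateDualityOrderForE`:
`#H¹(K_v, E[n]) = (#E(K_v)[n] · #(𝓞_v/n))²` (the second factor is `1` off `p`).
[cite: MilneADT2006, Ch. I, Thm. 2.8 and Lemma 2.9] -/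
theorem hEuler_of_eq_pow {p : ℕ} [Fact p.Prime] (n : ℕ) [NeZero n] {k : ℕ} (hk : k ≠ 0) (hn : n = p ^ k)
    (hpv : (p : 𝓞 K) ∉ v.asIdeal) :
    Nat.card (galoisCohomology
        (GaloisRep.restrictField (v.adicCompletion K) (W.torsionGaloisModule (n : ℤ))) 1) =
      (Nat.card (nsmulAddMonoidHom n :
            (W.baseChange (v.adicCompletion K)).toAffine.Point →+ _).ker *
          Nat.card (v.adicCompletionIntegers K ⧸
            Ideal.span {(n : v.adicCompletionIntegers K)})) ^ 2 := by
  have hnv : (n : 𝓞 K) ∉ v.asIdeal := fun h ↦ by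
    rw [hn, Nat.cast_pow] at h
    exact hpv (v.isPrime.mem_of_pow_mem k h)
  rw [natCard_adicCompletionIntegers_quotient_span_natCast_eq_one v hnv, mul_one]
  exact natCard_galoisCohomology_one_torsion_eq_sq_of_eq_pow v W n hk hn hpv

/-- ★ **`𝓛_v^⊥ ⊆ 𝓛_v` for `inv ∘ weilLocalCup` at `v ∤ p`, level `m² = p^k`** — the hypothesis `hperp` of
`inv_weilLocalCup_ne_zero_or_of_line` / `ctLocalTerm_ne_zero_or_of_line` (#40), for `e` alternating and
non-degenerate and any injective reading `inv` of `H²(Γ_{K_v}, μ_{m²})` (e.g. the canonical invariant at a finite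
place): the tree's `forall_mem_kummerLocalConditionAt_weilCupProduct_eq_zero_iff_of_eulerChar` (Milne I Cor. 3.4 /
Lemma 6.15; Poonen–Rains Prop. 4.10) fed with `hEuler_of_eq_pow`. [cite: MilneADT2006, Ch. I, Cor. 3.4 and Lemma 6.15]
[cite: PoonenRains2012, Prop. 4.10] -/
theorem mem_kummerLocalConditionAt_of_forall_inv_weilLocalCup_eq_zero (m : ℕ) [NeZero m]
    {p k : ℕ} [Fact p.Prime] (hk : k ≠ 0) (hmm : m * m = p ^ k) (hpv : (p : 𝓞 K) ∉ v.asIdeal)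
    (e : geomTorsion W ((m * m : ℕ) : ℤ) → geomTorsion W ((m * m : ℕ) : ℤ) → AlgebraicClosure K)
    (hμ : ∀ S T, e S T ^ (m * m) = 1)
    (hadd₁ : ∀ S₁ S₂ T, e (S₁ + S₂) T = e S₁ T * e S₂ T)
    (hadd₂ : ∀ S T₁ T₂, e S (T₁ + T₂) = e S T₁ * e S T₂)
    (hgal : ∀ (σ : absoluteGaloisGroup K) (S T : geomTorsion W ((m * m : ℕ) : ℤ)),
      σ • e S T = e (σ • S) (σ • T))
    (halt : ∀ T, e T T = 1) (hnondeg : ∀ T, (∀ S, e S T = 1) → T = 0)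
    {C : Type*} [AddCommGroup C]
    (inv : galoisCohomology (GaloisRep.restrictField (v.adicCompletion K) (mu K (m * m))) 2 →+ C)
    (hinv : Function.Injective inv)
    (x : galoisCohomology
      (GaloisRep.restrictField (v.adicCompletion K) (W.torsionGaloisModule ((m * m : ℕ) : ℤ))) 1)
    (hx : ∀ y ∈ W.kummerLocalConditionAt ((m * m : ℕ) : ℤ) (v.adicCompletion K),
      inv (weilLocalCup W m (v.adicCompletion K) e hμ hadd₁ hadd₂ hgal x y) = 0) :
    x ∈ W.kummerLocalConditionAt ((m * m : ℕ) : ℤ) (v.adicCompletion K) := by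
  haveI : NeZero (m * m) := ⟨mul_ne_zero (NeZero.ne m) (NeZero.ne m)⟩
  refine (forall_mem_kummerLocalConditionAt_weilCupProduct_eq_zero_iff_of_eulerChar W v (m * m) e hμ
    hadd₁ hadd₂ hgal halt hnondeg (hEuler_of_eq_pow v W (m * m) hk hmm hpv) x).mp fun y hy ↦ hinv ?_
  have h := hx y hy
  rw [weilLocalCup_apply] at h
  exact h.trans (map_zero inv).symm

end Perp

end Literature.NumberTheory.EllipticCurves

end
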